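import Mathlib
import HarnessLib

/-!
# The unit ball `𝔹² ⊂ ℂ²` as a homogeneous space of `U(2,1)`

The BALL MODEL of the complex hyperbolic plane, in coordinates: the indefinite unitary group
`U(2,1) = {g ∈ GL₃(ℂ) : gᴴ J g = J}`, `J = diag(1, 1, -1)`, acts on the unit ball
`𝔹² = {z ∈ ℂ² : |z₀|² + |z₁|² < 1}` by the projective (fractional-linear) maps
`g • z = ((g(z,1))₀, (g(z,1))₁) / (g(z,1))₂`, continuously and TRANSITIVELY.

* `J`, `U21 ≤ GL3`, `mat`, `mkU21` — the form and the group; `Q v = |v₀|² + |v₁|² - |v₂|²` is the real quadratic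
  form of `J` (`form_eq_Q`) and is `U(2,1)`-invariant (`Q_mulVec`);
* `Ball`, `x₀ = 0`, `lift z = (z₀, z₁, 1)` (a `J`-negative vector), `proj` (back to the ball), `W3 g z = g · lift z`,
  `act`; `instMulActionU21Ball` (a `MulAction`), `instContinuousSMulU21Ball`;
* `boostMat`, `rotMat` — a boost in the `(z₀, 1)`-plane and a block rotation `blockdiag(u, 1)`, `u ∈ U(2)`;
  `exists_smul_x₀_eq` (every point is a translate of `0`) and **`transitive`**.

Source: H. Jacobowitz, *An Introduction to CR Structures*, Math. Surveys Monogr. 32 (AMS 1990), Ch. 2 §1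
(pp. 35–42; the items below sit on pp. 40–41): `U(2,1) = {A : A* C A = C}`, `C = diag(-1, 1, 1)`, its
fractional-linear action on `ℂ²`, Lemma 6 (`U(2,1)` is transitive on `B`; isotropy of the origin `U(1) × U(2)`;
`B = U(2,1)/U(1) × U(2)`) and Theorem 4 (`Aut B = U(2,1)` acting this way). Jacobowitz puts the negative
coordinate FIRST (`ζ₀`); we put it LAST (`J = diag(1,1,-1)`, affine chart `w₂ = 1`) — the same group after a
cyclic permutation of coordinates. Transitivity of `Aut(B)` is also W. Rudin, *Function Theory in the Unit
Ball of ℂⁿ* (Springer 1980), Thm 2.2.3 (via the involutions `φ_a`). Everything below is PROVED.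

## Provenance

Staged by the pub-hodgecm formalisation cell (DAG-node prover #03 lineage) under the LEAN-IN-TREE rule; it
supersedes §§ "form and group", "Hermitian form", "ball and action", "transitivity" of the cell's standalone
package file `HodgeCM/PerL34/Ball.lean` (namespace `HodgeCM.PerL34.BallModel` ↦
`Literature.Geometry.ComplexHyperbolic.BallModel`, short names unchanged). The Jacobian cocycle of the action
and the isotropy representation at `x₀` are the sibling files `UnitBallJacobian.lean`, `UnitBallIsotropy.lean`.

## Not here

`PU(2,1)` (we keep the non-effective `U(2,1)`); the Bergman metric; the Siegel-domain model; higher `n`.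
-/

set_option autoImplicit false

noncomputable section

open Matrix Complex ComplexConjugate

namespace Literature.Geometry.ComplexHyperbolic

namespace BallModel

/-! ### The form `J` and the group `U(2,1)` -/

/-- `J = diag(1, 1, -1)` on `ℂ³` (Jacobowitz's `C = diag(-1,1,1)` with the negative coordinate moved last).
[cite: Jacobowitz1990, Ch. 2 §1 (p. 40)] -/
def J : Matrix (Fin 3) (Fin 3) ℂ := Matrix.diagonal ![1, 1, -1]

/-- `J₀₀ = 1`. [folklore] -/
@[simp] theorem J_apply_00 : J 0 0 = 1 := by simp [J]

/-- `J₁₁ = 1`. [folklore] -/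
@[simp] theorem J_apply_11 : J 1 1 = 1 := by simp [J]

/-- `J₂₂ = -1`. [folklore] -/
@[simp] theorem J_apply_22 : J 2 2 = -1 := by simp [J]

/-- `J` is diagonal. [folklore] -/
theorem J_apply_of_ne {i j : Fin 3} (h : i ≠ j) : J i j = 0 := by simp [J, Matrix.diagonal_apply_ne _ h]

/-- `det J = -1`. [folklore] -/
theorem det_J : J.det = -1 := by simp [J, Matrix.det_diagonal, Fin.prod_univ_three]

/-- The ambient group `GL₃(ℂ)`. [folklore] -/
abbrev GL3 : Type := GL (Fin 3) ℂ

/-- `U(2,1) = {g ∈ GL₃(ℂ) : gᴴ J g = J}` as a subgroup of `GL₃(ℂ)` ("`U(2,1) = {A : A*CA = C}`").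
[cite: Jacobowitz1990, Ch. 2 §1 (p. 40)] -/
def U21 : Subgroup GL3 where
  carrier := {g | (g : Matrix (Fin 3) (Fin 3) ℂ)ᴴ * J * (g : Matrix (Fin 3) (Fin 3) ℂ) = J}
  mul_mem' := by
    intro g h hg hh
    simp only [Set.mem_setOf_eq, Units.val_mul, conjTranspose_mul] at hg hh ⊢
    calc (h : Matrix (Fin 3) (Fin 3) ℂ)ᴴ * (g : Matrix (Fin 3) (Fin 3) ℂ)ᴴ * J *
          ((g : Matrix (Fin 3) (Fin 3) ℂ) * (h : Matrix (Fin 3) (Fin 3) ℂ))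
        = (h : Matrix (Fin 3) (Fin 3) ℂ)ᴴ * ((g : Matrix (Fin 3) (Fin 3) ℂ)ᴴ * J *
          (g : Matrix (Fin 3) (Fin 3) ℂ)) * (h : Matrix (Fin 3) (Fin 3) ℂ) := by
          simp only [Matrix.mul_assoc]
      _ = J := by rw [hg, hh]
  one_mem' := by simp
  inv_mem' := by
    intro g hg
    simp only [Set.mem_setOf_eq] at hg ⊢
    set gi : Matrix (Fin 3) (Fin 3) ℂ := ((g⁻¹ : GL3) : Matrix (Fin 3) (Fin 3) ℂ) with hgi
    have hmul : (g : Matrix (Fin 3) (Fin 3) ℂ) * gi = 1 := by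
      rw [hgi, ← Units.val_mul, mul_inv_cancel, Units.val_one]
    calc giᴴ * J * gi = giᴴ * ((g : Matrix (Fin 3) (Fin 3) ℂ)ᴴ * J * (g : Matrix (Fin 3) (Fin 3) ℂ)) * gi := by
          rw [hg]
      _ = ((g : Matrix (Fin 3) (Fin 3) ℂ) * gi)ᴴ * J * ((g : Matrix (Fin 3) (Fin 3) ℂ) * gi) := by
          simp only [conjTranspose_mul, Matrix.mul_assoc]
      _ = J := by rw [hmul]; simp

/-- The matrix of an element of `U(2,1)`. [folklore] -/
abbrev mat (g : U21) : Matrix (Fin 3) (Fin 3) ℂ := ((g : GL3) : Matrix (Fin 3) (Fin 3) ℂ)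

/-- The defining relation `gᴴ J g = J`. [folklore] -/
theorem mat_mem (g : U21) : (mat g)ᴴ * J * mat g = J := g.2

/-- `mat` is multiplicative. [folklore] -/
@[simp] theorem mat_mul (g h : U21) : mat (g * h) = mat g * mat h := by simp [mat]

/-- `mat 1 = 1`. [folklore] -/
@[simp] theorem mat_one : mat 1 = 1 := by simp [mat]

/-- `mat` is continuous (subspace topology of `U(2,1) ⊂ GL₃(ℂ)`). [folklore] -/
theorem continuous_mat : Continuous mat :=
  Units.continuous_val.comp continuous_subtype_val

/-- A matrix preserving `J` has non-zero determinant. [folklore] -/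
theorem det_ne_zero_of_preserves {g : Matrix (Fin 3) (Fin 3) ℂ} (h : gᴴ * J * g = J) : g.det ≠ 0 := by
  intro h0
  have := congrArg Matrix.det h
  rw [det_mul, det_mul, h0, mul_zero, det_J] at this
  norm_num at this

/-- Constructor: a matrix preserving `J` defines an element of `U(2,1)`. [folklore] -/
def mkU21 (g : Matrix (Fin 3) (Fin 3) ℂ) (h : gᴴ * J * g = J) : U21 :=
  ⟨Matrix.GeneralLinearGroup.mkOfDetNeZero g (det_ne_zero_of_preserves h), h⟩

/-- `mat (mkU21 g h) = g`. [folklore] -/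
@[simp] theorem mat_mkU21 (g : Matrix (Fin 3) (Fin 3) ℂ) (h : gᴴ * J * g = J) : mat (mkU21 g h) = g := rfl

/-- Elements of `U(2,1)` have non-zero determinant. [folklore] -/
theorem det_mat_ne_zero (g : U21) : (mat g).det ≠ 0 := det_ne_zero_of_preserves (mat_mem g)

/-! ### The Hermitian form of signature `(2,1)` and its invariance -/

/-- The real quadratic form `Q(v) = |v₀|² + |v₁|² - |v₂|²` of `J`. [cite: Jacobowitz1990, Ch. 2 §1 (p. 40)] -/
def Q (v : Fin 3 → ℂ) : ℝ := ‖v 0‖ ^ 2 + ‖v 1‖ ^ 2 - ‖v 2‖ ^ 2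

/-- `v̄ᵀ J v = Q(v)`. [folklore] -/
theorem form_eq_Q (v : Fin 3 → ℂ) : star v ⬝ᵥ (J *ᵥ v) = ((Q v : ℝ) : ℂ) := by
  have h0 := Complex.conj_mul' (v 0)
  have h1 := Complex.conj_mul' (v 1)
  have h2 := Complex.conj_mul' (v 2)
  simp only [J, mulVec_diagonal, dotProduct, Fin.sum_univ_three, Pi.star_apply, Complex.star_def, Q,
    Matrix.cons_val_zero, Matrix.cons_val_one, Matrix.cons_val]
  push_cast
  linear_combination h0 + h1 - h2

/-- A matrix preserving `J` preserves the sesquilinear form `v̄ᵀ J v`. [folklore] -/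
theorem form_invariant {g : Matrix (Fin 3) (Fin 3) ℂ} (h : gᴴ * J * g = J) (v : Fin 3 → ℂ) :
    star (g *ᵥ v) ⬝ᵥ (J *ᵥ (g *ᵥ v)) = star v ⬝ᵥ (J *ᵥ v) := by
  rw [Matrix.star_mulVec, Matrix.mulVec_mulVec, Matrix.dotProduct_mulVec, Matrix.vecMul_vecMul,
    ← Matrix.mul_assoc, h, ← Matrix.dotProduct_mulVec]

/-- `Q(g v) = Q(v)` for `g` preserving `J`. [folklore] -/
theorem Q_mulVec {g : Matrix (Fin 3) (Fin 3) ℂ} (h : gᴴ * J * g = J) (v : Fin 3 → ℂ) : Q (g *ᵥ v) = Q v := by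
  have := form_invariant h v
  rw [form_eq_Q, form_eq_Q] at this
  exact_mod_cast this

/-! ### The ball and the action -/

/-- `|z₀|² + |z₁|²`. [folklore] -/
def nsq (z : Fin 2 → ℂ) : ℝ := ‖z 0‖ ^ 2 + ‖z 1‖ ^ 2

/-- `0 ≤ |z₀|² + |z₁|²`. [folklore] -/
theorem nsq_nonneg (z : Fin 2 → ℂ) : 0 ≤ nsq z := by unfold nsq; positivity

/-- `|z₀|² + |z₁|² > 0` for `z ≠ 0`. [folklore] -/
theorem nsq_pos_of_ne_zero {z : Fin 2 → ℂ} (hz : z ≠ 0) : 0 < nsq z := by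
  refine lt_of_le_of_ne (nsq_nonneg z) fun h => hz ?_
  have h0 : ‖z 0‖ ^ 2 = 0 := by unfold nsq at h; nlinarith [sq_nonneg ‖z 0‖, sq_nonneg ‖z 1‖]
  have h1 : ‖z 1‖ ^ 2 = 0 := by unfold nsq at h; nlinarith [sq_nonneg ‖z 0‖, sq_nonneg ‖z 1‖]
  have e0 : z 0 = 0 := by simpa using h0
  have e1 : z 1 = 0 := by simpa using h1
  funext i
  fin_cases i
  · exact e0
  · exact e1

/-- The complex 2-ball `𝔹² = {z ∈ ℂ² : |z₀|² + |z₁|² < 1}` (a type). [cite: Jacobowitz1990, Ch. 2 §1 (p. 37)] -/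
def Ball : Type := {z : Fin 2 → ℂ // nsq z < 1}

/-- The subspace topology of `𝔹² ⊂ ℂ²`. [folklore] -/
instance : TopologicalSpace Ball := instTopologicalSpaceSubtype

/-- The base point `x₀ = 0 ∈ 𝔹²`. [folklore] -/
def x₀ : Ball := ⟨0, by simp [nsq]⟩

/-- `x₀ = 0`. [folklore] -/
@[simp] theorem x₀_val : (x₀.1 : Fin 2 → ℂ) = 0 := rfl

/-- Two points of the ball with the same coordinates are equal. [folklore] -/
theorem Ball.ext {z z' : Ball} (h : ∀ i, z.1 i = z'.1 i) : z = z' := Subtype.ext (funext h)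

/-- The lift `z ↦ (z₀, z₁, 1) ∈ ℂ³` of a point of the ball (a `J`-negative vector; homogeneous coordinates with
`w₂ = 1`). [folklore] -/
def lift (z : Ball) : Fin 3 → ℂ := ![z.1 0, z.1 1, 1]

/-- `(lift z)₀ = z₀`. [folklore] -/
@[simp] theorem lift_0 (z : Ball) : lift z 0 = z.1 0 := rfl

/-- `(lift z)₁ = z₁`. [folklore] -/
@[simp] theorem lift_1 (z : Ball) : lift z 1 = z.1 1 := rfl

/-- `(lift z)₂ = 1`. [folklore] -/
@[simp] theorem lift_2 (z : Ball) : lift z 2 = 1 := rfl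

/-- The lift of a point of the ball is `J`-negative. [folklore] -/
theorem Q_lift (z : Ball) : Q (lift z) < 0 := by
  have := z.2; simp only [Q, lift_0, lift_1, lift_2, norm_one, one_pow, nsq] at this ⊢; linarith

/-- For a `J`-negative vector the last coordinate does not vanish. [folklore] -/
theorem ne_zero_of_Q_neg {w : Fin 3 → ℂ} (hw : Q w < 0) : w 2 ≠ 0 := by
  intro h; simp only [Q, h, norm_zero] at hw; nlinarith [sq_nonneg ‖w 0‖, sq_nonneg ‖w 1‖]

/-- Projection of a `J`-negative vector to the ball: `w ↦ (w₀/w₂, w₁/w₂)`. [folklore] -/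
def proj (w : Fin 3 → ℂ) (hw : Q w < 0) : Ball :=
  ⟨![w 0 / w 2, w 1 / w 2], by
    have h2 := ne_zero_of_Q_neg hw
    have hpos : 0 < ‖w 2‖ ^ 2 := by positivity
    simp only [nsq, Matrix.cons_val_zero, Matrix.cons_val_one, norm_div, div_pow]
    rw [← add_div, div_lt_one hpos]
    simp only [Q] at hw; linarith⟩

/-- `(proj w)₀ = w₀ / w₂`. [folklore] -/
@[simp] theorem proj_val_0 (w : Fin 3 → ℂ) (hw : Q w < 0) : (proj w hw).1 0 = w 0 / w 2 := rfl

/-- `(proj w)₁ = w₁ / w₂`. [folklore] -/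
@[simp] theorem proj_val_1 (w : Fin 3 → ℂ) (hw : Q w < 0) : (proj w hw).1 1 = w 1 / w 2 := rfl

/-- `(proj w)ᵢ = wᵢ / w₂`. [folklore] -/
theorem proj_val (w : Fin 3 → ℂ) (hw : Q w < 0) (i : Fin 2) :
    (proj w hw).1 i = w (Fin.castSucc i) / w 2 := by
  fin_cases i <;> rfl

/-- The image `g · (z, 1)` of the lift. [folklore] -/
def W3 (g : U21) (z : Ball) : Fin 3 → ℂ := mat g *ᵥ lift z

/-- `g · (z, 1)` is `J`-negative. [folklore] -/
theorem Q_W3 (g : U21) (z : Ball) : Q (W3 g z) < 0 := by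
  unfold W3; rw [Q_mulVec (mat_mem g)]; exact Q_lift z

/-- The denominator `(g · (z,1))₂` of the action never vanishes on the ball. [folklore] -/
theorem W3_2_ne_zero (g : U21) (z : Ball) : W3 g z 2 ≠ 0 := ne_zero_of_Q_neg (Q_W3 g z)

/-- `(g · (z,1))ₖ = g_{k0} z₀ + g_{k1} z₁ + g_{k2}`. [folklore] -/
theorem W3_apply (g : U21) (z : Ball) (k : Fin 3) :
    W3 g z k = mat g k 0 * z.1 0 + mat g k 1 * z.1 1 + mat g k 2 := by
  simp [W3, mulVec, dotProduct, Fin.sum_univ_three]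

/-- The action `g • z := proj (g · lift z)`, i.e. the fractional-linear map
`z ↦ ((g(z,1))₀, (g(z,1))₁) / (g(z,1))₂`. [cite: Jacobowitz1990, Ch. 2 §1 (p. 40)] -/
def act (g : U21) (z : Ball) : Ball := proj (W3 g z) (Q_W3 g z)

/-- Coordinates of `act g z`. [folklore] -/
theorem act_val (g : U21) (z : Ball) (i : Fin 2) : (act g z).1 i = W3 g z (Fin.castSucc i) / W3 g z 2 :=
  proj_val _ _ i

/-- `lift (g • z) = (g·(z,1))₂⁻¹ • g·(z,1)`. [folklore] -/
theorem lift_act (g : U21) (z : Ball) : lift (act g z) = (W3 g z 2)⁻¹ • W3 g z := by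
  have h2 := W3_2_ne_zero g z
  funext k
  fin_cases k
  · simp [act, div_eq_inv_mul]
  · simp [act, div_eq_inv_mul]
  · simp [h2]

/-- The fractional-linear action of `U(2,1)` on `𝔹²` is a group action.
[cite: Jacobowitz1990, Ch. 2 §1, Lemma 6 (p. 41)] -/
instance instMulActionU21Ball : MulAction U21 Ball where
  smul := act
  one_smul z := by
    apply Ball.ext; intro i
    change (act 1 z).1 i = z.1 i
    rw [act_val]
    fin_cases i <;> simp [W3]
  mul_smul g h z := by
    apply Ball.ext; intro i
    change (act (g * h) z).1 i = (act g (act h z)).1 i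
    rw [act_val, act_val]
    have hW : W3 g (act h z) = (W3 h z 2)⁻¹ • (mat g *ᵥ W3 h z) := by
      unfold W3; rw [lift_act, Matrix.mulVec_smul]; rfl
    have hgh : W3 (g * h) z = mat g *ᵥ W3 h z := by
      unfold W3; rw [mat_mul, ← Matrix.mulVec_mulVec]
    rw [hW, hgh]
    have h2 := W3_2_ne_zero h z
    simp only [Pi.smul_apply, smul_eq_mul]
    rw [mul_div_mul_left _ _ (inv_ne_zero h2)]

/-- `g • z = act g z`. [folklore] -/
theorem smul_def (g : U21) (z : Ball) : g • z = act g z := rfl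

/-- Coordinates of `g • z`. [folklore] -/
theorem smul_val (g : U21) (z : Ball) (i : Fin 2) : (g • z).1 i = W3 g z (Fin.castSucc i) / W3 g z 2 :=
  act_val g z i

/-- Continuity of `(g, z) ↦ (g · lift z)ₖ`. [folklore] -/
theorem continuous_W3 (k : Fin 3) : Continuous fun p : U21 × Ball => W3 p.1 p.2 k := by
  have hm : Continuous fun p : U21 × Ball => mat p.1 := continuous_mat.comp continuous_fst
  have hz : ∀ i : Fin 2, Continuous fun p : U21 × Ball => p.2.1 i := fun i =>
    (continuous_apply i).comp (continuous_subtype_val.comp continuous_snd)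
  simp only [W3_apply]
  exact (((hm.matrix_elem k 0).mul (hz 0)).add ((hm.matrix_elem k 1).mul (hz 1))).add (hm.matrix_elem k 2)

/-- The action `U(2,1) × 𝔹² → 𝔹²` is jointly continuous. [folklore] -/
instance instContinuousSMulU21Ball : ContinuousSMul U21 Ball where
  continuous_smul := by
    refine Topology.IsEmbedding.subtypeVal.continuous_iff.2 (continuous_pi fun i => ?_)
    exact ((continuous_W3 _).div (continuous_W3 2) fun p => W3_2_ne_zero p.1 p.2).congr
      fun p => (smul_val p.1 p.2 i).symm

/-- Continuity of `g ↦ (g · lift z)ₖ`. [folklore] -/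
theorem continuous_W3_left (z : Ball) (k : Fin 3) : Continuous fun g : U21 => W3 g z k :=
  (continuous_W3 k).comp (continuous_id.prodMk continuous_const)

/-! ### Transitivity -/

/-- The boost `B(c,d)` in the `(z₀, 1)`-plane, `c² - d² = 1`. [folklore] -/
def boostMat (c d : ℝ) : Matrix (Fin 3) (Fin 3) ℂ := !![(c : ℂ), 0, d; 0, 1, 0; d, 0, c]

/-- A boost preserves `J`. [folklore] -/
theorem boostMat_mem (c d : ℝ) (h : c ^ 2 - d ^ 2 = 1) : (boostMat c d)ᴴ * J * boostMat c d = J := by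
  have hC : (c : ℂ) ^ 2 - (d : ℂ) ^ 2 = 1 := by exact_mod_cast h
  ext i j
  fin_cases i <;> fin_cases j <;>
    simp [boostMat, J, Matrix.mul_apply, Fin.sum_univ_three, conjTranspose_apply, Matrix.diagonal_apply] <;>
    first | linear_combination hC | linear_combination -hC | ring1

/-- The rotation `blockdiag(u, 1)`, `u = r⁻¹ (z₀, -z̄₁; z₁, z̄₀) ∈ U(2)` for `|z₀|² + |z₁|² = r²`. [folklore] -/
def rotMat (z : Fin 2 → ℂ) (r : ℝ) : Matrix (Fin 3) (Fin 3) ℂ :=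
  !![z 0 / r, -conj (z 1) / r, 0; z 1 / r, conj (z 0) / r, 0; 0, 0, 1]

/-- A block rotation preserves `J`. [folklore] -/
theorem rotMat_mem (z : Fin 2 → ℂ) (r : ℝ) (hr : r ≠ 0)
    (h : conj (z 0) * z 0 + conj (z 1) * z 1 = (r : ℂ) ^ 2) : (rotMat z r)ᴴ * J * rotMat z r = J := by
  have hrC : (r : ℂ) ≠ 0 := by exact_mod_cast hr
  ext i j
  fin_cases i <;> fin_cases j <;>
    simp [rotMat, J, Matrix.mul_apply, Fin.sum_univ_three, conjTranspose_apply, Matrix.diagonal_apply] <;>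
    field_simp <;>
    first | linear_combination h | linear_combination -h | ring1

/-- Every point of the ball is a translate of `x₀ = 0`: `z = R(z) B(|z|) • 0` with a boost followed by a block
rotation. [cite: Jacobowitz1990, Ch. 2 §1, Lemma 6(1) (p. 41)] -/
theorem exists_smul_x₀_eq (z : Ball) : ∃ g : U21, g • x₀ = z := by
  by_cases hz : z.1 = 0
  · refine ⟨1, ?_⟩
    rw [one_smul]
    exact Ball.ext fun i => by simp [hz]
  · have hn0 : 0 < nsq z.1 := nsq_pos_of_ne_zero hz
    have hn1 : nsq z.1 < 1 := z.2
    set r : ℝ := Real.sqrt (nsq z.1) with hr_def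
    set t : ℝ := Real.sqrt (1 - nsq z.1) with ht_def
    have hr : 0 < r := Real.sqrt_pos.2 hn0
    have ht : 0 < t := Real.sqrt_pos.2 (by linarith)
    have hr2 : r ^ 2 = nsq z.1 := Real.sq_sqrt hn0.le
    have ht2 : t ^ 2 = 1 - nsq z.1 := Real.sq_sqrt (by linarith)
    have hcd : (1 / t) ^ 2 - (r / t) ^ 2 = 1 := by
      rw [div_pow, div_pow, ← sub_div, one_pow, hr2, ht2]
      exact div_self (by linarith)
    have hzr : conj (z.1 0) * z.1 0 + conj (z.1 1) * z.1 1 = (r : ℂ) ^ 2 := by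
      rw [Complex.conj_mul', Complex.conj_mul']
      have : r ^ 2 = ‖z.1 0‖ ^ 2 + ‖z.1 1‖ ^ 2 := hr2
      exact_mod_cast this.symm
    let B : U21 := mkU21 (boostMat (1 / t) (r / t)) (boostMat_mem _ _ hcd)
    let R : U21 := mkU21 (rotMat z.1 r) (rotMat_mem z.1 r hr.ne' hzr)
    have hrC : (r : ℂ) ≠ 0 := by exact_mod_cast hr.ne'
    have htC : (t : ℂ) ≠ 0 := by exact_mod_cast ht.ne'
    have hB0 : (B • x₀).1 0 = r := by
      rw [smul_val, W3_apply, W3_apply]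
      simp [B, boostMat]
      field_simp
    have hB1 : (B • x₀).1 1 = 0 := by
      rw [smul_val, W3_apply, W3_apply]
      simp [B, boostMat]
    refine ⟨R * B, ?_⟩
    rw [mul_smul]
    apply Ball.ext
    intro i
    rw [smul_val, W3_apply, W3_apply, hB0, hB1]
    fin_cases i
    · simp [R, rotMat]; field_simp
    · simp [R, rotMat]; field_simp

/-- **`U(2,1)` acts transitively on `𝔹²`.** [cite: Jacobowitz1990, Ch. 2 §1, Lemma 6(1) (p. 41)] -/
theorem transitive (x : Ball) : Function.Surjective fun g : U21 => g • x := by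
  intro y
  obtain ⟨g, hg⟩ := exists_smul_x₀_eq x
  obtain ⟨h, hh⟩ := exists_smul_x₀_eq y
  refine ⟨h * g⁻¹, ?_⟩
  show (h * g⁻¹) • x = y
  rw [mul_smul, ← hg, inv_smul_smul, hh]

end BallModel

end Literature.Geometry.ComplexHyperbolic

end
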